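import Summits.PneNP.PneNP.Theorems.PhaseTwinsPolyDepthTwinsAboveAcDefs

/-!
# Route PhaseTwins, crux `PolyDepthTwinsAbove` (stmt-PneNP-2719), line `annealed-cover-twins`:
typed perfect matchings — definitions and the peeling bijection (milestone M1 of `stub_annealedPortLaw`, part 1)

The first-moment input of the annealed port law of ONE cover gadget. An independent set of the
cover gadget is a TYPING `t : Fin n' → Bool × Bool` of the indices (`(t x).1` = layer `0`
occupied, `(t x).2` = layer `1` occupied), and a perfect matching `σ` (a fixed-point-free
involution, `fpfInv`) is compatible with it (`compatInv t`) iff no matched pair `{x, σ x}` has `x`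
occupied in layer `0` and `σ x` occupied in layer `1`; the allowed pairs of types are `{00, *}`,
`{10, 10}`, `{01, 01}` (`okPair`). This file: the counting functions `pmCount` (perfect matchings of
`m` points), `ninv n₀₀ n₁₀ n₀₁ n₁₁` (the typed count, by the peeling recursion: a `11` point is
matched to a `00` point, a `10` point to a `10` or a `00` point, symmetrically for `01`), the
summands `ninvTerm` of its closed form (by the numbers `u`, `v` of `{00,10}` and `{00,01}` pairs),
and the one-pair peeling bijection `card_compatInv_peel` with its bookkeeping
(`card_compatInv_peel_counts`, `tcount_restrict`) — the involution analogue of the tree's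
`card_perm_filter_forall_not_mem` (permutation model). The exact count `card_compatInv` is the
sequel file `…AcPortLawCount`. [folklore]
-/

noncomputable section

open scoped Classical BigOperators

namespace Summit.PneNP.PneNP.Cruxes.PolyDepthTwinsAbove.AnnealedCoverTwins

open Finset

set_option linter.dupNamespace false
set_option linter.unusedSectionVars false

/-! ## Perfect matchings of `m` points and the peeling recursion -/

/-- The number of perfect matchings (fixed-point-free involutions) of `m` labelled points:
`PM(0) = 1`, `PM(1) = 0`, `PM(m+2) = (m+1)·PM(m)` (so `PM(2j) = (2j-1)!!`, `PM(odd) = 0`). -/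
def pmCount : ℕ → ℕ
  | 0 => 1
  | 1 => 0
  | m + 2 => (m + 1) * pmCount m

/-- `PM(0) = 1`. -/
@[simp] theorem pmCount_zero : pmCount 0 = 1 := rfl

/-- `PM(1) = 0`. -/
@[simp] theorem pmCount_one : pmCount 1 = 0 := rfl

/-- `PM(m+2) = (m+1) PM(m)`. -/
theorem pmCount_add_two (m : ℕ) : pmCount (m + 2) = (m + 1) * pmCount m := rfl

/-- `(m-1) PM(m-2) = PM(m)` for `m ≥ 1` (peeling the pair through a fixed point). -/
theorem pred_mul_pmCount {m : ℕ} (hm : 1 ≤ m) : (m - 1) * pmCount (m - 2) = pmCount m := by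
  obtain ⟨k, rfl⟩ : ∃ k, m = k + 1 := ⟨m - 1, by omega⟩
  cases k with
  | zero => simp
  | succ k => simp [pmCount_add_two]

/-- The typed matching count with no `11` and no `10` points, `A(n₀₀, n₀₁)`: peel a `01` point
(partner `01` or `00`). -/
def ninvA : ℕ → ℕ → ℕ
  | n00, 0 => pmCount n00
  | n00, 1 => n00 * ninvA (n00 - 1) 0
  | n00, n01 + 2 => (n01 + 1) * ninvA n00 n01 + n00 * ninvA (n00 - 1) (n01 + 1)

/-- The typed matching count with no `11` points, `B(n₀₀, n₁₀, n₀₁)`: peel a `10` point (partner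
`10` or `00`). -/
def ninvB : ℕ → ℕ → ℕ → ℕ
  | n00, 0, n01 => ninvA n00 n01
  | n00, 1, n01 => n00 * ninvB (n00 - 1) 0 n01
  | n00, n10 + 2, n01 => (n10 + 1) * ninvB n00 n10 n01 + n00 * ninvB (n00 - 1) (n10 + 1) n01

/-- **The typed matching count** `Ninv(n₀₀, n₁₀, n₀₁, n₁₁)`: the number of perfect matchings of
`n₀₀ + n₁₀ + n₀₁ + n₁₁` typed points using only the allowed pairs `{00,*}`, `{10,10}`, `{01,01}`
(peel a `11` point: its partner is a `00` point). -/
def ninv : ℕ → ℕ → ℕ → ℕ → ℕ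
  | n00, n10, n01, 0 => ninvB n00 n10 n01
  | n00, n10, n01, n11 + 1 => n00 * ninv (n00 - 1) n10 n01 n11

/-- Peeling a `11` point. -/
theorem ninv_succ11 (n00 n10 n01 n11 : ℕ) :
    ninv n00 n10 n01 (n11 + 1) = n00 * ninv (n00 - 1) n10 n01 n11 := rfl

/-- No `11` points. -/
theorem ninv_zero11 (n00 n10 n01 : ℕ) : ninv n00 n10 n01 0 = ninvB n00 n10 n01 := rfl

/-- Peeling a `10` point (no `11` points): `Ninv(n₀₀, n₁₀, n₀₁, 0) =
(n₁₀ - 1) Ninv(n₀₀, n₁₀ - 2, n₀₁, 0) + n₀₀ Ninv(n₀₀ - 1, n₁₀ - 1, n₀₁, 0)` for `n₁₀ ≥ 1`. -/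
theorem ninv_peel10 {n10 : ℕ} (h : 1 ≤ n10) (n00 n01 : ℕ) :
    ninv n00 n10 n01 0 =
      (n10 - 1) * ninv n00 (n10 - 2) n01 0 + n00 * ninv (n00 - 1) (n10 - 1) n01 0 := by
  obtain ⟨k, rfl⟩ : ∃ k, n10 = k + 1 := ⟨n10 - 1, by omega⟩
  cases k with
  | zero => simp [ninv, ninvB]
  | succ k => simp [ninv, ninvB]

/-- Peeling a `01` point (no `11`, no `10` points): `Ninv(n₀₀, 0, n₀₁, 0) =
(n₀₁ - 1) Ninv(n₀₀, 0, n₀₁ - 2, 0) + n₀₀ Ninv(n₀₀ - 1, 0, n₀₁ - 1, 0)` for `n₀₁ ≥ 1`. -/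
theorem ninv_peel01 {n01 : ℕ} (h : 1 ≤ n01) (n00 : ℕ) :
    ninv n00 0 n01 0 = (n01 - 1) * ninv n00 0 (n01 - 2) 0 + n00 * ninv (n00 - 1) 0 (n01 - 1) 0 := by
  obtain ⟨k, rfl⟩ : ∃ k, n01 = k + 1 := ⟨n01 - 1, by omega⟩
  cases k with
  | zero => simp [ninv, ninvB, ninvA]
  | succ k => simp [ninv, ninvB, ninvA]

/-- All points of type `00`: `Ninv(n, 0, 0, 0) = PM(n)`. -/
theorem ninv_zero (n00 : ℕ) : ninv n00 0 0 0 = pmCount n00 := by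
  simp [ninv, ninvB, ninvA]

/-- The `(u, v)` summand of the closed form of `Ninv`: choose the `u` type-`10` points and the `v`
type-`01` points matched to `00` points, inject them and all `11` points into the `00` points
(`n₀₀!/(n₀₀-u-v-n₁₁)!` ways), and match the rest of each class internally. -/
def ninvTerm (n00 n10 n01 n11 u v : ℕ) : ℕ :=
  n10.choose u * n01.choose v * n00.descFactorial (u + v + n11) *
    (pmCount (n10 - u) * pmCount (n01 - v) * pmCount (n00 - (u + v + n11)))

/-- The closed form `Σ_{u ≤ n₁₀, v ≤ n₀₁} ninvTerm` (proved equal to `ninv` in the sequel). -/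
def ninvSum (n00 n10 n01 n11 : ℕ) : ℕ :=
  ∑ u ∈ range (n10 + 1), ∑ v ∈ range (n01 + 1), ninvTerm n00 n10 n01 n11 u v

/-! ## Typings, compatible matchings, and the peeling bijection -/

section Typed

variable {α : Type*} [Fintype α] [DecidableEq α]

/-- The number of points of type `s` under the typing `t`. -/
def tcount (t : α → Bool × Bool) (s : Bool × Bool) : ℕ := (univ.filter fun x => t x = s).card

/-- An ordered pair of types `(s, s')` of matched points is allowed: not (`s` occupied in layer
`0` and `s'` occupied in layer `1`), and symmetrically. -/
def okPair (s s' : Bool × Bool) : Bool := !(s.1 && s'.2) && !(s'.1 && s.2)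

/-- `okPair` is symmetric. -/
theorem okPair_comm (s s' : Bool × Bool) : okPair s s' = okPair s' s := by
  simp only [okPair, Bool.and_comm]

/-- The perfect matchings (fixed-point-free involutions) compatible with the typing `t`: no point
occupied in layer `0` is matched to a point occupied in layer `1`. -/
def compatInv (t : α → Bool × Bool) : Finset (Equiv.Perm α) :=
  (fpfInv α).filter fun σ => ∀ x, (t x).1 = true → (t (σ x)).2 = false

/-- Membership in `compatInv`. -/
theorem mem_compatInv {t : α → Bool × Bool} {σ : Equiv.Perm α} :
    σ ∈ compatInv t ↔
      (∀ x, σ (σ x) = x) ∧ (∀ x, σ x ≠ x) ∧ ∀ x, (t x).1 = true → (t (σ x)).2 = false := by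
  simp only [compatInv, fpfInv, mem_filter, mem_univ, true_and, and_assoc]

/-- In a compatible matching every matched pair is allowed (both orientations). -/
theorem okPair_of_mem_compatInv {t : α → Bool × Bool} {σ : Equiv.Perm α} (hσ : σ ∈ compatInv t)
    (x : α) : okPair (t x) (t (σ x)) = true := by
  obtain ⟨hinv, -, hc⟩ := mem_compatInv.1 hσ
  have h1 := hc x
  have h2 := hc (σ x)
  rw [hinv] at h2
  simp only [okPair, Bool.and_eq_true, Bool.not_eq_true', Bool.and_eq_false_imp]
  -- `!(a && b) = true ↔ (a = true → b = false)`
  constructor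
  · cases h : (t x).1 <;> simp_all
  · cases h : (t (σ x)).1 <;> simp_all

/-- **The peeling bijection.** Removing the pair `{x₀, σ x₀}` from a compatible perfect matching
leaves a compatible perfect matching of the remaining points (with the restricted typing), and
every partner `y ≠ x₀` of allowed type occurs: `#compat(t) = Σ_{y ≠ x₀ allowed} #compat(t|{x₀,y}ᶜ)`. -/
theorem card_compatInv_peel (t : α → Bool × Bool) (x₀ : α) :
    (compatInv t).card =
      ∑ y ∈ univ.filter (fun y => y ≠ x₀ ∧ okPair (t x₀) (t y) = true),
        (compatInv fun z : {z // z ≠ x₀ ∧ z ≠ y} => t z).card := by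
  have hmaps : ∀ σ ∈ compatInv t,
      σ x₀ ∈ univ.filter (fun y => y ≠ x₀ ∧ okPair (t x₀) (t y) = true) := by
    intro σ hσ
    simp only [mem_filter, mem_univ, true_and]
    exact ⟨(mem_compatInv.1 hσ).2.1 x₀, okPair_of_mem_compatInv hσ x₀⟩
  rw [Finset.card_eq_sum_card_fiberwise hmaps]
  refine Finset.sum_congr rfl fun y hy => ?_
  simp only [mem_filter, mem_univ, true_and] at hy
  obtain ⟨hyx, hok⟩ := hy
  -- the complement `{x₀, y}` as a subtype, and the swap on it
  set p : α → Prop := fun z => z ≠ x₀ ∧ z ≠ y with hp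
  have hx₀ : ¬ p x₀ := fun h => h.1 rfl
  have hy' : ¬ p y := fun h => h.2 rfl
  set sw : Equiv.Perm {a // ¬ p a} := Equiv.swap ⟨x₀, hx₀⟩ ⟨y, hy'⟩ with hsw
  -- invariance of `p` under a matching `σ` with `σ x₀ = y`
  have hpσ : ∀ σ : Equiv.Perm α, (∀ x, σ (σ x) = x) → σ x₀ = y → ∀ z, p (σ z) ↔ p z := by
    intro σ hinv h0 z
    have hy0 : σ y = x₀ := by rw [← h0, hinv]
    simp only [hp]
    constructor
    · rintro ⟨h1, h2⟩
      refine ⟨fun hz => h2 (by rw [hz, h0]), fun hz => h1 (by rw [hz, hy0])⟩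
    · rintro ⟨h1, h2⟩
      refine ⟨fun hz => h2 (σ.injective (by rw [hz, hy0])), fun hz => h1 (σ.injective (by rw [hz, h0]))⟩
  refine Finset.card_bij'
    (fun σ hσ => σ.subtypePerm (hpσ σ (mem_compatInv.1 (mem_filter.1 hσ).1).1 (mem_filter.1 hσ).2))
    (fun σ' _ => Equiv.Perm.subtypeCongr σ' sw) ?_ ?_ ?_ ?_
  · -- restriction lands in the compatible matchings of the rest
    intro σ hσ
    obtain ⟨hσ, h0⟩ := mem_filter.1 hσ
    obtain ⟨hinv, hfpf, hc⟩ := mem_compatInv.1 hσ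
    refine mem_compatInv.2 ⟨fun z => Subtype.ext (by simp [hinv]), fun z hz => hfpf z ?_, fun z hz => ?_⟩
    · exact congrArg Subtype.val hz
    · simpa using hc z hz
  · -- extension lands in the fibre
    intro σ' hσ'
    obtain ⟨hinv, hfpf, hc⟩ := mem_compatInv.1 hσ'
    have e0 : Equiv.Perm.subtypeCongr σ' sw x₀ = y := by
      rw [Equiv.Perm.subtypeCongr.right_apply σ' sw hx₀, hsw, Equiv.swap_apply_left]
    have ey : Equiv.Perm.subtypeCongr σ' sw y = x₀ := by
      rw [Equiv.Perm.subtypeCongr.right_apply σ' sw hy', hsw, Equiv.swap_apply_right]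
    have ez : ∀ z (hz : p z), Equiv.Perm.subtypeCongr σ' sw z = σ' ⟨z, hz⟩ := fun z hz =>
      Equiv.Perm.subtypeCongr.left_apply σ' sw hz
    refine mem_filter.2 ⟨mem_compatInv.2 ⟨fun z => ?_, fun z => ?_, fun z hz => ?_⟩, e0⟩
    · by_cases hz : p z
      · rw [ez z hz, ez _ (σ' ⟨z, hz⟩).2]
        have := hinv ⟨z, hz⟩
        simpa using congrArg Subtype.val this
      · by_cases hzx : z = x₀
        · subst hzx; rw [e0, ey]
        · have hzy : z = y := by
            by_contra hzy; exact hz ⟨hzx, hzy⟩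
          subst hzy; rw [ey, e0]
    · by_cases hz : p z
      · rw [ez z hz]
        intro h
        exact hfpf ⟨z, hz⟩ (Subtype.ext h)
      · by_cases hzx : z = x₀
        · subst hzx; rw [e0]; exact hyx
        · have hzy : z = y := by
            by_contra hzy; exact hz ⟨hzx, hzy⟩
          subst hzy; rw [ey]; exact fun h => hyx h.symm
    · by_cases hz' : p z
      · rw [ez z hz']
        exact hc ⟨z, hz'⟩ hz
      · by_cases hzx : z = x₀
        · subst hzx; rw [e0]
          have := hok
          simp only [okPair, Bool.and_eq_true, Bool.not_eq_true'] at this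
          simpa [hz] using this.1
        · have hzy : z = y := by
            by_contra hzy; exact hz' ⟨hzx, hzy⟩
          subst hzy; rw [ey]
          have := hok
          simp only [okPair, Bool.and_eq_true, Bool.not_eq_true'] at this
          simpa [hz] using this.2
  · -- left inverse
    intro σ hσ
    obtain ⟨hσ', h0⟩ := mem_filter.1 hσ
    obtain ⟨hinv, -, -⟩ := mem_compatInv.1 hσ'
    have hy0 : σ y = x₀ := by rw [← h0, hinv]
    ext z
    by_cases hz : p z
    · rw [Equiv.Perm.subtypeCongr.left_apply _ sw hz, Equiv.Perm.subtypePerm_apply]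
    · rw [Equiv.Perm.subtypeCongr.right_apply _ sw hz]
      by_cases hzx : z = x₀
      · subst hzx; rw [hsw, Equiv.swap_apply_left, h0]
      · have hzy : z = y := by
          by_contra hzy; exact hz ⟨hzx, hzy⟩
        subst hzy; rw [hsw, Equiv.swap_apply_right, hy0]
  · -- right inverse
    intro σ' _
    ext z
    rw [Equiv.Perm.subtypePerm_apply]
    exact Equiv.Perm.subtypeCongr.left_apply_subtype σ' sw z


/-- Type counts of the restricted typing after removing two distinct points `x₀`, `y`. -/
theorem tcount_restrict (t : α → Bool × Bool) {x₀ y : α} (hyx : y ≠ x₀) (s : Bool × Bool) :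
    tcount (fun z : {z // z ≠ x₀ ∧ z ≠ y} => t z) s =
      tcount t s - (if t x₀ = s then 1 else 0) - (if t y = s then 1 else 0) := by
  unfold tcount
  have h1 : (univ.filter fun z : {z // z ≠ x₀ ∧ z ≠ y} => t z = s).card =
      (((univ.filter fun x => t x = s).erase x₀).erase y).card := by
    rw [← Finset.card_map (Function.Embedding.subtype _)]
    congr 1
    ext z
    simp only [mem_map, mem_filter, mem_univ, true_and, Function.Embedding.coe_subtype,
      Subtype.exists, exists_and_left, exists_prop, exists_eq_right_right, mem_erase]
    tauto
  rw [h1, Finset.card_erase_eq_ite, Finset.card_erase_eq_ite]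
  simp only [mem_erase, mem_filter, mem_univ, true_and, ne_eq, hyx, not_false_eq_true]
  by_cases hx : t x₀ = s <;> by_cases hy : t y = s <;> simp [hx, hy]

/-- The peeling sum grouped by the type of the partner: if the count of the rest depends only on
the partner's type (`G`), then `#compat(t) = Σ_s [s allowed] · (N_s - [t x₀ = s]) · G s`. -/
theorem card_compatInv_peel_counts (t : α → Bool × Bool) (x₀ : α) (G : Bool × Bool → ℕ)
    (hG : ∀ y, y ≠ x₀ → (compatInv fun z : {z // z ≠ x₀ ∧ z ≠ y} => t z).card = G (t y)) :
    (compatInv t).card =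
      ∑ s : Bool × Bool,
        (if okPair (t x₀) s = true then tcount t s - (if t x₀ = s then 1 else 0) else 0) * G s := by
  rw [card_compatInv_peel t x₀]
  set S := univ.filter (fun y => y ≠ x₀ ∧ okPair (t x₀) (t y) = true) with hS
  rw [← Finset.sum_fiberwise S t]
  refine Finset.sum_congr rfl fun s _ => ?_
  have hfib : ∀ y ∈ S.filter (fun y => t y = s),
      (compatInv fun z : {z // z ≠ x₀ ∧ z ≠ y} => t z).card = G s := by
    intro y hy
    simp only [hS, mem_filter, mem_univ, true_and] at hy
    rw [hG y hy.1.1, hy.2]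
  rw [Finset.sum_congr rfl hfib, Finset.sum_const, smul_eq_mul]
  congr 1
  by_cases hok : okPair (t x₀) s = true
  · rw [if_pos hok]
    have : S.filter (fun y => t y = s) = (univ.filter fun x => t x = s).erase x₀ := by
      ext y
      simp only [hS, mem_filter, mem_univ, true_and, mem_erase]
      constructor
      · rintro ⟨⟨h1, -⟩, h3⟩; exact ⟨h1, h3⟩
      · rintro ⟨h1, h3⟩; exact ⟨⟨h1, by rw [h3]; exact hok⟩, h3⟩
    rw [this, Finset.card_erase_eq_ite]
    unfold tcount
    simp only [mem_filter, mem_univ, true_and]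
    by_cases hx : t x₀ = s <;> simp [hx]
  · rw [if_neg hok]
    have : S.filter (fun y => t y = s) = ∅ := by
      ext y
      simp only [hS, mem_filter, mem_univ, true_and, Finset.notMem_empty, iff_false, not_and]
      rintro ⟨-, h2⟩ h3
      rw [h3] at h2
      exact hok h2
    rw [this, Finset.card_empty]

/-- The rest has two points fewer. -/
theorem card_subtype_ne_ne {x₀ y : α} (hyx : y ≠ x₀) :
    Fintype.card {z // z ≠ x₀ ∧ z ≠ y} = Fintype.card α - 2 := by
  rw [Fintype.card_subtype]
  have : (univ.filter fun z : α => z ≠ x₀ ∧ z ≠ y) = (univ.erase x₀).erase y := by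
    ext z
    simp only [mem_filter, mem_univ, true_and, mem_erase]
    tauto
  rw [this, Finset.card_erase_of_mem (by simp [hyx]), Finset.card_erase_of_mem (mem_univ _),
    Finset.card_univ]
  omega

/-- A point of type `s` exists iff `N_s > 0`. -/
theorem tcount_pos_iff (t : α → Bool × Bool) (s : Bool × Bool) :
    0 < tcount t s ↔ ∃ x, t x = s := by
  unfold tcount
  rw [Finset.card_pos]
  constructor
  · rintro ⟨x, hx⟩
    exact ⟨x, (mem_filter.1 hx).2⟩
  · rintro ⟨x, hx⟩
    exact ⟨x, mem_filter.2 ⟨mem_univ _, hx⟩⟩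

/-- The four type counts add up to the number of points. -/
theorem sum_tcount (t : α → Bool × Bool) :
    tcount t (false, false) + tcount t (true, false) + tcount t (false, true) + tcount t (true, true) =
      Fintype.card α := by
  have h := (Finset.card_eq_sum_card_fiberwise (s := (univ : Finset α)) (t := (univ : Finset (Bool × Bool)))
    (f := t) fun _ _ => mem_univ _)
  rw [Finset.card_univ] at h
  rw [h, Fintype.sum_prod_type]
  simp only [Fintype.sum_bool, tcount]
  ring

end Typed


end Summit.PneNP.PneNP.Cruxes.PolyDepthTwinsAbove.AnnealedCoverTwins
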